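import Mathlib.NumberTheory.Harmonic.ZetaAsymp
import Mathlib.Analysis.Calculus.Deriv.Star
import Mathlib.Analysis.Complex.CauchyIntegral
import Mathlib.Analysis.Complex.RemovableSingularity
import Literature.NumberTheory.LFunctions.ZetaZeros
import Literature.NumberTheory.LFunctions.GeneralizedRH
import Literature.NumberTheory.LFunctions.ZetaRealAxis
import HarnessLib

/-!
# Discharges of named facts of `ZetaZeros.lean`: conjugation symmetry of the multiplicities

Discharge of the named fact `Literature.NumberTheory.LFunctions.riemannZetaZeroOrder_conj` (`Literature/…/ZetaZeros.lean`;
Titchmarsh §2.12): `m(ρ̄) = m(ρ)` for every `ρ`, where `m = Literature.riemannZetaZeroOrder` is the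
meromorphic order of `ζ`. Proof: `ζ(s̄) = ζ(s)̄` (Mathlib `riemannZeta_conj`), so near `ρ` the
function `ζ` is `conj ∘ ζ ∘ conj`, and a local factorisation `ζ(z) = (z − ρ̄)ⁿ g(z)` at `ρ̄`
conjugates to `ζ(z) = (z − ρ)ⁿ conj(g(z̄))` at `ρ`; at the pole `ρ = 1 = 1̄` there is nothing to
prove.

Discharge of the named fact `Literature.NumberTheory.LFunctions.mem_riemannZetaNontrivialZeros_iff` (same file; Titchmarsh §2.12):
the non-trivial zeros of `ζ` are exactly its zeros with `0 < Re ρ < 1`. Proof: `ζ ≠ 0` on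
`Re s ≥ 1` (Mathlib `riemannZeta_ne_zero_of_one_le_re`), and a zero with `Re ρ ≤ 0` is a trivial
zero (`Literature.NumberTheory.LFunctions.riemannZeta_eq_zero_iff_of_re_nonpos`, `GeneralizedRH.lean`, from the functional
equation `riemannZeta_one_sub`).

Discharge of the named facts `Literature.NumberTheory.LFunctions.zetaZeroCountRe_mono_right` and `Literature.NumberTheory.LFunctions.zetaZeroCountRe_anti_left`
(same file; Titchmarsh §9.1): `N(σ, T)` is non-decreasing in `T` and non-increasing in `σ`.
Proof: the counting boxes `zetaZeroBox σ T` increase with `T` and decrease with `σ`, and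
`N(σ, T)` is a finite sum of non-negative multiplicities over the box
(`zetaZeroCountRe_le_of_subset`). Corollaries: `zetaZeroCount_mono`, `criticalZeroCount_mono`,
and `N(T) = N₀(T) = 0` for `T ≤ 0` (empty box).

Discharge of the named fact `Literature.NumberTheory.LFunctions.riemannHypothesisInStripUpTo_iff` (same file; Titchmarsh §2.12):
the two-sided strip form `RiemannHypothesisInStripUpTo T` (zeros with `0 < Re ρ < 1`, `|Im ρ| ≤ T`)
is equivalent to the upper-half-strip form `∀ s, ζ s = 0 → 0 < Im s → Im s ≤ T → Re s = 1/2`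
(= `Literature.RiemannHypothesisUpTo T`). Proof: a zero with `Im s ≠ 0` lies in the open strip
(`Literature.NumberTheory.LFunctions.riemannZeta_eq_zero_iff_of_re_nonpos`, `riemannZeta_ne_zero_of_one_le_re`); a zero with
`Im ρ < 0` is moved to `conj ρ` (Mathlib `riemannZeta_conj`); and `ζ` has no real zeros in `(0, 1)`
(`Literature.NumberTheory.LFunctions.riemannZeta_ne_zero_of_im_eq_zero_of_pos_of_lt_one`, `ZetaRealAxis.lean`).

Discharge of the named fact `Literature.NumberTheory.LFunctions.riemannZetaZeroOrder_one` (same file; Titchmarsh §2.1):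
`m(1) = -1`, the simple pole of `ζ` at `s = 1`. Proof: `g(s) = (s − 1) ζ(s)` with `g(1) := 1` is
analytic at `1` (differentiable on a punctured neighbourhood, continuous at `1` by Mathlib
`riemannZeta_residue_one`, removable singularity), `g(1) ≠ 0`, and `ζ(s) = (s − 1)⁻¹ g(s)` near
`1` (`meromorphicOrderAt_eq_int_iff`).

## References

* E. C. Titchmarsh, *The Theory of the Riemann Zeta-function*, 2nd ed. (OUP 1986), §2.12, §9.1.
-/

noncomputable section

open Complex Filter Topology
open scoped ComplexConjugate

namespace Literature.NumberTheory.LFunctions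

/-- If `h` is analytic at `z̄₀` then `z ↦ conj (h z̄)` is analytic at `z₀` (complex
differentiability on a neighbourhood, Mathlib `differentiableAt_conj_conj_iff`). [folklore] -/
theorem analyticAt_conj_conj {h : ℂ → ℂ} {z₀ : ℂ} (hh : AnalyticAt ℂ h (conj z₀)) :
    AnalyticAt ℂ (fun z ↦ conj (h (conj z))) z₀ := by
  rw [analyticAt_iff_eventually_differentiableAt] at hh ⊢
  have ht : Tendsto (conj : ℂ → ℂ) (𝓝 z₀) (𝓝 (conj z₀)) := continuous_conj.tendsto z₀
  filter_upwards [ht.eventually hh] with z hz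
  exact (differentiableAt_conj_conj_iff.mpr hz : DifferentiableAt ℂ (conj ∘ h ∘ conj) z)

/-- The order of vanishing of `z ↦ conj (f z̄)` at `z₀` equals that of `f` at `z̄₀`. [folklore] -/
theorem analyticOrderAt_conj_conj {f : ℂ → ℂ} {z₀ : ℂ} (hf : AnalyticAt ℂ f (conj z₀)) :
    analyticOrderAt (fun z ↦ conj (f (conj z))) z₀ = analyticOrderAt f (conj z₀) := by
  have hg : AnalyticAt ℂ (fun z ↦ conj (f (conj z))) z₀ := analyticAt_conj_conj hf
  have ht : Tendsto (conj : ℂ → ℂ) (𝓝 z₀) (𝓝 (conj z₀)) := continuous_conj.tendsto z₀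
  cases h : analyticOrderAt f (conj z₀) with
  | top =>
    rw [analyticOrderAt_eq_top] at h ⊢
    filter_upwards [ht.eventually h] with z hz
    simp [hz]
  | coe n =>
    obtain ⟨g, hg_an, hg_ne, hg_eq⟩ := hf.analyticOrderAt_eq_natCast.mp h
    rw [hg.analyticOrderAt_eq_natCast]
    refine ⟨fun z ↦ conj (g (conj z)), analyticAt_conj_conj hg_an, ?_, ?_⟩
    · simpa using hg_ne
    · filter_upwards [ht.eventually hg_eq] with z hz
      simp only [hz, smul_eq_mul, map_mul, map_pow, map_sub, conj_conj]

/-- **Discharge of `Literature.NumberTheory.LFunctions.riemannZetaZeroOrder_conj`** (Titchmarsh §2.12): `m(ρ̄) = m(ρ)` for all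
`ρ`, from `ζ(s̄) = conj ζ(s)` (`riemannZeta_conj`). [cite: Titchmarsh1986, §2.12] -/
theorem riemannZetaZeroOrder_conj_holds : riemannZetaZeroOrder_conj := by
  intro ρ
  by_cases h1 : ρ = 1
  · subst h1; simp
  have h1' : conj ρ ≠ 1 := by
    intro h; apply h1; simpa using congrArg conj h
  unfold riemannZetaZeroOrder
  rw [(analyticOn_riemannZeta _ h1').meromorphicOrderAt_eq,
    (analyticOn_riemannZeta _ h1).meromorphicOrderAt_eq]
  congr 2
  rw [← analyticOrderAt_conj_conj (analyticOn_riemannZeta _ h1')]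
  congr 1
  ext z
  rw [riemannZeta_conj, conj_conj]

/-! ## Discharge of `Literature.NumberTheory.LFunctions.mem_riemannZetaNontrivialZeros_iff` -/

/-- **Discharge of `Literature.NumberTheory.LFunctions.mem_riemannZetaNontrivialZeros_iff`** (Titchmarsh §2.12): the non-trivial
zeros of `ζ` are exactly its zeros in the open critical strip `0 < Re ρ < 1`
(`riemannZeta_ne_zero_of_one_le_re` gives `Re ρ < 1`; a zero with `Re ρ ≤ 0` is trivial by
`Literature.NumberTheory.LFunctions.riemannZeta_eq_zero_iff_of_re_nonpos`, the functional equation; conversely `-2(n+1)` has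
negative real part). [cite: Titchmarsh1986, §2.12] -/
theorem mem_riemannZetaNontrivialZeros_iff_holds : mem_riemannZetaNontrivialZeros_iff := by
  intro ρ
  constructor
  · rintro ⟨h0, htriv⟩
    have h0 : riemannZeta ρ = 0 := h0
    refine ⟨h0, ?_, ?_⟩
    · by_contra hle
      obtain ⟨n, hn⟩ := (riemannZeta_eq_zero_iff_of_re_nonpos (not_lt.1 hle)).1 h0
      exact htriv ⟨n, hn.symm⟩
    · by_contra hge
      exact riemannZeta_ne_zero_of_one_le_re (not_lt.1 hge) h0
  · rintro ⟨h0, h1, -⟩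
    refine ⟨h0, ?_⟩
    rintro ⟨n, hn⟩
    have := congrArg Complex.re hn
    simp at this
    have : (0 : ℝ) ≤ n := n.cast_nonneg
    linarith


/-! ## Discharge of the monotonicity facts `zetaZeroCountRe_mono_right` / `_anti_left` -/

/-- Multiplicities are non-negative on every counting box (indeed positive:
`riemannZetaZeroOrder_pos_iff`; a point of a box has `Im ρ > 0`, so `ρ ≠ 1`). [folklore] -/
theorem riemannZetaZeroOrder_nonneg_of_mem_zetaZeroBox {σ T : ℝ} {ρ : ℂ}
    (h : ρ ∈ zetaZeroBox σ T) : 0 ≤ riemannZetaZeroOrder ρ := by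
  obtain ⟨-, -, -, h3, -⟩ := h
  refine riemannZetaZeroOrder_nonneg ?_
  rintro rfl
  simp at h3

/-- Box inclusion gives an inequality of counts: if `zetaZeroBox σ T ⊆ zetaZeroBox σ' T'` then
`N(σ, T) ≤ N(σ', T')` (a sub-sum of a finite sum of non-negative multiplicities). [folklore] -/
theorem zetaZeroCountRe_le_of_subset {σ T σ' T' : ℝ}
    (h : zetaZeroBox σ T ⊆ zetaZeroBox σ' T') : zetaZeroCountRe σ T ≤ zetaZeroCountRe σ' T' := by
  have hB : (zetaZeroBox σ' T').Finite := zetaZeroBox_finite σ' T'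
  have hA : (zetaZeroBox σ T).Finite := hB.subset h
  unfold zetaZeroCountRe
  refine Int.toNat_le_toNat ?_
  rw [finsum_mem_eq_finite_toFinset_sum _ hA, finsum_mem_eq_finite_toFinset_sum _ hB]
  refine Finset.sum_le_sum_of_subset_of_nonneg ((Set.Finite.toFinset_subset_toFinset).2 h) ?_
  intro ρ hρ _
  exact riemannZetaZeroOrder_nonneg_of_mem_zetaZeroBox ((Set.Finite.mem_toFinset hB).1 hρ)

/-- **Discharge of `Literature.NumberTheory.LFunctions.zetaZeroCountRe_mono_right`** (Titchmarsh §9.1): `N(σ, T)` is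
non-decreasing in `T` (the boxes increase with `T`). [cite: Titchmarsh1986, §9.1] -/
theorem zetaZeroCountRe_mono_right_holds : zetaZeroCountRe_mono_right := by
  intro σ T T' hTT'
  refine zetaZeroCountRe_le_of_subset ?_
  rintro ρ ⟨h0, h1, h2, h3, h4⟩
  exact ⟨h0, h1, h2, h3, h4.trans hTT'⟩

/-- **Discharge of `Literature.NumberTheory.LFunctions.zetaZeroCountRe_anti_left`** (Titchmarsh §9.1): `N(σ, T)` is
non-increasing in `σ` (the boxes shrink as `σ` increases). [cite: Titchmarsh1986, §9.1] -/
theorem zetaZeroCountRe_anti_left_holds : zetaZeroCountRe_anti_left := by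
  intro T σ σ' hσσ'
  refine zetaZeroCountRe_le_of_subset ?_
  rintro ρ ⟨h0, h1, h2, h3, h4⟩
  exact ⟨h0, hσσ'.trans h1, h2, h3, h4⟩

/-- `N(T)` is non-decreasing (`zetaZeroCountRe_mono_right_holds` at `σ = 0`). [folklore] -/
theorem zetaZeroCount_mono : Monotone zetaZeroCount :=
  zetaZeroCountRe_mono_right_holds 0

/-- `N(T) = 0` for `T ≤ 0`: the box `0 < Im ρ ≤ T` is empty. [folklore] -/
theorem zetaZeroCount_eq_zero_of_nonpos {T : ℝ} (hT : T ≤ 0) : zetaZeroCount T = 0 := by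
  have h : zetaZeroBox 0 T = ∅ := by
    ext ρ
    simp only [zetaZeroBox, Set.mem_setOf_eq, Set.mem_empty_iff_false, iff_false]
    rintro ⟨-, -, -, h3, h4⟩
    linarith
  simp [zetaZeroCount, zetaZeroCountRe, h]

/-- `N₀(T) = 0` for `T ≤ 0`: the box `0 < Im ρ ≤ T` is empty. [folklore] -/
theorem criticalZeroCount_eq_zero_of_nonpos {T : ℝ} (hT : T ≤ 0) : criticalZeroCount T = 0 := by
  have h : {ρ ∈ zetaZeroBox (1 / 2) T | ρ.re = 1 / 2} = ∅ := by
    ext ρ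
    simp only [zetaZeroBox, Set.mem_setOf_eq, Set.mem_empty_iff_false, iff_false]
    rintro ⟨⟨-, -, -, h3, h4⟩, -⟩
    linarith
  unfold criticalZeroCount
  rw [h]
  simp

/-- `N₀(T)` is non-decreasing in `T`. [folklore] -/
theorem criticalZeroCount_mono : Monotone criticalZeroCount := by
  intro T T' hTT'
  have hB : {ρ ∈ zetaZeroBox (1 / 2) T' | ρ.re = 1 / 2}.Finite :=
    (zetaZeroBox_finite _ _).subset (Set.sep_subset _ _)
  have hsub : {ρ ∈ zetaZeroBox (1 / 2) T | ρ.re = 1 / 2} ⊆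
      {ρ ∈ zetaZeroBox (1 / 2) T' | ρ.re = 1 / 2} := by
    rintro ρ ⟨⟨h0, h1, h2, h3, h4⟩, h5⟩
    exact ⟨⟨h0, h1, h2, h3, h4.trans hTT'⟩, h5⟩
  have hA := hB.subset hsub
  unfold criticalZeroCount
  refine Int.toNat_le_toNat ?_
  rw [finsum_mem_eq_finite_toFinset_sum _ hA, finsum_mem_eq_finite_toFinset_sum _ hB]
  refine Finset.sum_le_sum_of_subset_of_nonneg ((Set.Finite.toFinset_subset_toFinset).2 hsub) ?_
  intro ρ hρ _
  exact riemannZetaZeroOrder_nonneg_of_mem_zetaZeroBox ((Set.Finite.mem_toFinset hB).1 hρ).1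

/-! ### The strip form of RH up to height `T` -/

/-- A zero `s` of `ζ` off the real axis lies in the open critical strip `0 < Re s < 1`: `ζ ≠ 0` on
`Re s ≥ 1` (Mathlib `riemannZeta_ne_zero_of_one_le_re`) and a zero with `Re s ≤ 0` is a trivial zero
`-2(n+1)`, which is real (`Literature.NumberTheory.LFunctions.riemannZeta_eq_zero_iff_of_re_nonpos`). (Titchmarsh §2.12.)
[cite: Titchmarsh1986, §2.12] -/
theorem re_mem_Ioo_of_riemannZeta_eq_zero_of_im_ne_zero {s : ℂ} (hs : riemannZeta s = 0)
    (him : s.im ≠ 0) : 0 < s.re ∧ s.re < 1 := by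
  refine ⟨?_, not_le.1 fun h1 ↦ riemannZeta_ne_zero_of_one_le_re h1 hs⟩
  by_contra hle
  obtain ⟨n, hn⟩ := (riemannZeta_eq_zero_iff_of_re_nonpos (not_lt.1 hle)).1 hs
  apply him
  rw [hn]
  simp

/-- **Discharge of the named fact `riemannHypothesisInStripUpTo_iff`** (`ZetaZeros.lean`): for every
`T`, `RiemannHypothesisInStripUpTo T ↔ ∀ s, ζ s = 0 → 0 < Im s → Im s ≤ T → Re s = 1/2`.
(→): a zero with `0 < Im s` lies in the open strip
(`re_mem_Ioo_of_riemannZeta_eq_zero_of_im_ne_zero`) and `|Im s| = Im s`. (←): split on the sign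
of `Im ρ`; for `Im ρ < 0` use the conjugate zero `conj ρ` (Mathlib `riemannZeta_conj`; "the zeros
are in conjugate pairs", Titchmarsh §2.12), for `Im ρ = 0` there is no zero with `0 < Re ρ < 1`
(`Literature.NumberTheory.LFunctions.riemannZeta_ne_zero_of_im_eq_zero_of_pos_of_lt_one`, Titchmarsh §2.12, text after
(2.12.4)). [cite: Titchmarsh1986, §2.12] -/
theorem riemannHypothesisInStripUpTo_iff_holds : riemannHypothesisInStripUpTo_iff := by
  intro T
  constructor
  · intro h s hs h0 hT
    obtain ⟨hre0, hre1⟩ := re_mem_Ioo_of_riemannZeta_eq_zero_of_im_ne_zero hs h0.ne'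
    exact h s hs hre0 hre1 (by rwa [abs_of_pos h0])
  · intro h ρ hρ h0 h1 hT
    rcases lt_trichotomy ρ.im 0 with hneg | hzero | hpos
    · have hc : riemannZeta (conj ρ) = 0 := by rw [riemannZeta_conj, hρ, map_zero]
      have := h (conj ρ) hc (by simpa using hneg)
        (by rw [conj_im]; exact (neg_le_abs ρ.im).trans hT)
      simpa using this
    · exact absurd hρ (LFunctions.riemannZeta_ne_zero_of_im_eq_zero_of_pos_of_lt_one hzero h0 h1)
    · exact h ρ hρ hpos ((le_abs_self ρ.im).trans hT)

/-! ### The simple pole at `s = 1` -/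

/-- The regularised function `g(s) = (s − 1) ζ(s)` (value `1` at `s = 1`) is analytic at `1`:
it is differentiable on a punctured neighbourhood and continuous at `1` by
`riemannZeta_residue_one` (Riemann's removable singularity theorem). [folklore] -/
theorem analyticAt_update_sub_one_mul_riemannZeta :
    AnalyticAt ℂ (Function.update (fun s : ℂ ↦ (s - 1) * riemannZeta s) 1 1) 1 := by
  refine analyticAt_of_differentiable_on_punctured_nhds_of_continuousAt ?_ ?_
  · filter_upwards [self_mem_nhdsWithin] with z hz
    have hz' : z ≠ 1 := hz
    have hev : (Function.update (fun s : ℂ ↦ (s - 1) * riemannZeta s) 1 1) =ᶠ[𝓝 z]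
        fun s : ℂ ↦ (s - 1) * riemannZeta s := by
      filter_upwards [isOpen_ne.mem_nhds hz'] with w hw
      exact Function.update_of_ne hw _ _
    refine DifferentiableAt.congr_of_eventuallyEq ?_ hev
    exact ((differentiableAt_id.sub (differentiableAt_const _)).mul
      (differentiableAt_riemannZeta hz'))
  · exact continuousAt_update_same.2 riemannZeta_residue_one

/-- **Discharge of the named fact `riemannZetaZeroOrder_one`** (`ZetaZeros.lean`): `m(1) = -1`,
i.e. `ζ` has a simple pole at `s = 1`. Proof: with `g(s) = (s − 1) ζ(s)`, `g(1) := 1`, analytic at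
`1` (`analyticAt_update_sub_one_mul_riemannZeta`) and `g(1) = 1 ≠ 0`, one has
`ζ(s) = (s − 1)⁻¹ g(s)` for `s ≠ 1`, so the meromorphic order of `ζ` at `1` is `-1`
(`meromorphicOrderAt_eq_int_iff`). (Titchmarsh §2.1; Mathlib `riemannZeta_residue_one`.)
[cite: Titchmarsh1986, §2.1] -/
theorem riemannZetaZeroOrder_one_holds : riemannZetaZeroOrder_one := by
  set g : ℂ → ℂ := Function.update (fun s : ℂ ↦ (s - 1) * riemannZeta s) 1 1 with hg
  have hga : AnalyticAt ℂ g 1 := analyticAt_update_sub_one_mul_riemannZeta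
  have hg1 : g 1 = 1 := by simp [hg]
  have hev : ∀ᶠ z in 𝓝[≠] (1 : ℂ), riemannZeta z = (z - 1) ^ (-1 : ℤ) • g z := by
    filter_upwards [self_mem_nhdsWithin] with z hz
    have hz' : z ≠ 1 := hz
    have hgz : g z = (z - 1) * riemannZeta z := by simp [hg, Function.update_of_ne hz']
    rw [hgz, zpow_neg, zpow_one, smul_eq_mul, ← mul_assoc, inv_mul_cancel₀ (sub_ne_zero.2 hz'),
      one_mul]
  have hmero : MeromorphicAt riemannZeta 1 := by
    have h1 : MeromorphicAt (fun z : ℂ ↦ (z - 1) ^ (-1 : ℤ) • g z) 1 :=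
      (((MeromorphicAt.id 1).sub (MeromorphicAt.const 1 1)).zpow (-1)).smul hga.meromorphicAt
    exact h1.congr (hev.mono fun z hz ↦ hz.symm)
  have horder : meromorphicOrderAt riemannZeta 1 = (-1 : ℤ) :=
    (meromorphicOrderAt_eq_int_iff hmero).2 ⟨g, hga, by rw [hg1]; exact one_ne_zero, hev⟩
  show (meromorphicOrderAt riemannZeta 1).untop₀ = -1
  rw [horder]
  rfl

end Literature.NumberTheory.LFunctions

end
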